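import Mathlib.Algebra.MvPolynomial.Funext
import Summits.BirchSwinnertonDyer.Rank1Residual.Supersingular.X7SevenCongruenceCertificates
import Literature.NumberTheory.EllipticCurves.Fisher2014.HalberstadtKrausModelSevenCongruence
import HarnessLib

/-!
# `7`-congruence certificates in the kernel at the points `(1 : ∓3√c₄ : 0)` of `X_E(7)` — Fisher 2014 §4.4's formula `(F, d₂₂)`
# in Halberstadt–Kraus coordinates (the points where Theorem 4.8's `d₁` vanishes), for the companion records `341138s1`,
# `223587ck1`, `84966ea1` at `p = 7`

Cell `bsd-addord`, seat `bsd-addord-k1-c2` (D-0074 row B1), gen 10; `--supports stmt-BirchSwinnertonDyer-19357` (helper).  HONEST FRAMING: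
nothing here proves the Birch–Swinnerton-Dyer conjecture or the crux `GordTwoRankZeroOffCaseOne` (item 19357); THEOREMS + small
computable certificate definitions (sparse ternary forms; no mathematical content); no named fact introduced here; per pair; nothing booked.

WHAT THIS FILE DOES.  The companion records whose `7`-congruence `θ : F[7] ≃ W[7]` is still a DISPLAYED hypothesis
(`…Companion.bsdp_c84966ea1_7_of_congr` / `…_c341138s1_7_of_congr` of gen 4, `…CompanionX4.bsdp_c223587ck1_7_of_congr` of gen 9)
are exactly the pairs whose point on `X_W(7)` lies on the chart `z = 0` of Fisher's Theorem 3.9 quartic, `P = (s : 1 : 0)`, `s² = c₄(W)`,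
where Theorem 4.8's cubic form `d₁` VANISHES (gen 6's certificate finder, kit j281106: "d = 0"), so the tree's certificate theorem
`sevenCongruent_of_twistCertificate7` does not apply.  In the Halberstadt–Kraus coordinates of Theorem 1.1 (Remark 3.10) these are the
points `(1 : ∓3s : 0)`, at which §4.4's `d₁₁ = d₁₂ = d₁₃ = d₁₄ = 0` but `d₂₂ = −432(c₆ ± s³) ≠ 0`; §4.4's formula "(4.8) with
`(F, d) = (F, d_ii)` for any `i`" with `i = 2` (Literature fact `Fisher2014.sec44_sevenCongruent_hkQuartic7_d22`, the ONE named
hypothesis `hF` below) gives the partner.  Here, exactly as in `X7SevenCongruenceCertificates.lean` (whose generic kernel evaluators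
`hAt` / `c4At` / `c6At` and `eval_kleinH_eq` / `eval_kleinC4_eq` / `eval_kleinC6_eq` are reused verbatim), `θ` is SUPPLIED from a
KERNEL CERTIFICATE `(x, y, z, u)`: `F(P) = 0`, `d₂₂(P) ≠ 0`, `H(F)(P) ≠ 0`, `c₄(F)(P) = u⁴·c₄(partner)·d₂₂(P)²`,
`c₆(F)(P) = u⁶·c₆(partner)·d₂₂(P)³`, each `decide +kernel` on exact rationals.  The three certificates were found EXACTLY (the point is
forced; `u² = (c₆-ratio)/(c₄-ratio)`) and re-verified in exact rational arithmetic outside the kernel (kit j288075; cell record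
`HOME/bsd-addord/k1-c2/g10/klein/`).

References: T. Fisher, LMS J. Comput. Math. 17 (2014) 536–564, Thm. 1.1, Rem. 3.10, §3.2, Thm. 4.6, (4.8), §4.4
[Fisher2014SevenElevenCongruent]; E. Halberstadt, A. Kraus, Experiment. Math. 12 (2003) [HalberstadtKraus2003XE7]; Cremona's tables
[Cremona2006].
-/

set_option autoImplicit false

set_option linter.dupNamespace false

open MvPolynomial WeierstrassCurve
open Literature.NumberTheory.EllipticCurves.Fisher2012 (c4c6Model exists_geomTorsion_addEquiv_c4c6Model
  variableChange_shortModel_eq_c4c6Model)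
open Literature.NumberTheory.EllipticCurves.Fisher2014
open Summit.BirchSwinnertonDyer.Rank1Residual.Supersingular
open Summit.BirchSwinnertonDyer.Rank1Residual.Supersingular.TernaryPoly

namespace Summit.BirchSwinnertonDyer.BirchSwinnertonDyer.Theorems.AdditiveBranchIMCGordTwoRankZeroCompanionKleinHK

/-! ### Computable mirrors of Theorem 1.1's quartic `F` and §4.4's `d₂₂` (for `a = −27c₄`, `b = −54c₆`) -/

/-- Theorem 1.1's quartic `F = ax⁴ + 7bx³z + 3x²y² − 3a²x²z² − 6bxyz² − 5abxz³ + 2y³z + 3ay²z² + 2a²yz³ − 4b²z⁴` at `a = −27c₄`,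
`b = −54c₆`, as a sparse polynomial. [cite: Fisher2014SevenElevenCongruent, Thm. 1.1 (the quartic F) with Rem. 3.10] -/
def cHKQuartic7 (c₄ c₆ : ℚ) : Poly :=
  [⟨4, 0, 0, -27 * c₄⟩, ⟨3, 0, 1, 7 * (-54 * c₆)⟩, ⟨2, 2, 0, 3⟩, ⟨2, 0, 2, -(3 * (-27 * c₄) ^ 2)⟩, ⟨1, 1, 2, -(6 * (-54 * c₆))⟩,
    ⟨1, 0, 3, -(5 * (-27 * c₄) * (-54 * c₆))⟩, ⟨0, 3, 1, 2⟩, ⟨0, 2, 2, 3 * (-27 * c₄)⟩, ⟨0, 1, 3, 2 * (-27 * c₄) ^ 2⟩,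
    ⟨0, 0, 4, -(4 * (-54 * c₆) ^ 2)⟩]

/-- §4.4's `d₂₂ = 2(4bx³ − 2ax²y − 3a²x²z − 6bxyz + 3ay²z + 2a²yz² − 5abxz² + 2y³ − 4b²z³)` at `a = −27c₄`, `b = −54c₆`, as a sparse
polynomial. [cite: Fisher2014SevenElevenCongruent, §4.4 (d₁₁d_ij ≡ d_1i d_1j mod F)] -/
def cHKCubic7d22 (c₄ c₆ : ℚ) : Poly :=
  [⟨3, 0, 0, 8 * (-54 * c₆)⟩, ⟨2, 1, 0, -(4 * (-27 * c₄))⟩, ⟨2, 0, 1, -(6 * (-27 * c₄) ^ 2)⟩, ⟨1, 1, 1, -(12 * (-54 * c₆))⟩,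
    ⟨0, 2, 1, 6 * (-27 * c₄)⟩, ⟨0, 1, 2, 4 * (-27 * c₄) ^ 2⟩, ⟨1, 0, 2, -(10 * (-27 * c₄) * (-54 * c₆))⟩, ⟨0, 3, 0, 4⟩,
    ⟨0, 0, 3, -(8 * (-54 * c₆) ^ 2)⟩]

/-- A vector on `Fin 3` is `![v 0, v 1, v 2]`. [folklore] -/
private theorem vec3_eta (v : Fin 3 → ℚ) : v = ![v 0, v 1, v 2] := by
  ext i; fin_cases i <;> rfl

/-- `toMv (cHKQuartic7 c₄ c₆) = hkQuartic7 c₄ c₆` (the mirror is faithful). [cite: Fisher2014SevenElevenCongruent, Thm. 1.1] -/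
theorem toMv_cHKQuartic7 (c₄ c₆ : ℚ) : toMv (cHKQuartic7 c₄ c₆) = hkQuartic7 c₄ c₆ := by
  apply MvPolynomial.funext
  intro v
  rw [vec3_eta v, eval_toMv]
  simp only [TernaryPoly.eval, cHKQuartic7, hkQuartic7, hkQuartic7ab, List.map_cons, List.map_nil, List.sum_cons, List.sum_nil,
    map_add, map_sub, map_mul, map_pow, map_neg, map_ofNat, eval_C, eval_X, Matrix.cons_val_zero, Matrix.cons_val_one,
    Matrix.cons_val]
  ring

/-- `toMv (cHKCubic7d22 c₄ c₆) = hkCubic7d22 c₄ c₆`. [cite: Fisher2014SevenElevenCongruent, §4.4] -/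
theorem toMv_cHKCubic7d22 (c₄ c₆ : ℚ) : toMv (cHKCubic7d22 c₄ c₆) = hkCubic7d22 c₄ c₆ := by
  apply MvPolynomial.funext
  intro v
  rw [vec3_eta v, eval_toMv]
  simp only [TernaryPoly.eval, cHKCubic7d22, hkCubic7d22, hkCubic7d22ab, List.map_cons, List.map_nil, List.sum_cons,
    List.sum_nil, map_add, map_sub, map_mul, map_pow, map_neg, map_ofNat, eval_C, eval_X, Matrix.cons_val_zero,
    Matrix.cons_val_one, Matrix.cons_val]
  ring

/-! ### The certificate theorem -/

/-- From `C • P = c4c6Model (c₄ G) (c₆ G)` and an equivariant `P[7] ≃ W[7]`, an equivariant `G[7] ≃ W[7]` (the plumbing of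
`X7SevenCongruenceCertificates`, restated because it is private there). [folklore] -/
private theorem sevenCongruent_of_variableChange_eq_c4c6Model (W G P : WeierstrassCurve ℚ)
    (C : VariableChange ℚ) (hC : C • P = c4c6Model G.c₄ G.c₆)
    (hP : ∃ e : geomTorsion P (7 : ℤ) ≃+ geomTorsion W (7 : ℤ),
      ∀ (σ : Field.absoluteGaloisGroup ℚ) (T : geomTorsion P (7 : ℤ)), e (σ • T) = σ • e T) :
    ∃ e : geomTorsion G (7 : ℤ) ≃+ geomTorsion W (7 : ℤ),
      ∀ (σ : Field.absoluteGaloisGroup ℚ) (T : geomTorsion G (7 : ℤ)), e (σ • T) = σ • e T := by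
  obtain ⟨e₁, he₁⟩ := hP
  obtain ⟨e₂, he₂⟩ := exists_geomTorsion_addEquiv_c4c6Model G 7
  have h₃ := P.exists_geomTorsion_addEquiv_smul C 7
  rw [hC] at h₃
  obtain ⟨e₃, he₃⟩ := h₃
  refine ⟨(e₂.trans e₃.symm).trans e₁, fun σ T => ?_⟩
  simp only [AddEquiv.trans_apply]
  rw [← he₁]
  congr 1
  apply e₃.injective
  rw [AddEquiv.apply_symm_apply, he₃, AddEquiv.apply_symm_apply, he₂]

/-- **`7`-congruence from a kernel certificate on `X_W(7)` in Halberstadt–Kraus coordinates, at a point off `{d₂₂ = 0}`.**  Let `W, G`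
be elliptic curves over `ℚ` with `c₄(W) = c₄ ≠ 0`, `c₆(W) = c₆ ≠ 0` (`j(W) ≠ 0, 1728`), `c₄(G) = g₄`, `c₆(G) = g₆`, and let
`x y z u : ℚ`, `u ≠ 0`, satisfy — in exact rational arithmetic, `decide`-able — `F(P) = 0` (`P = (x:y:z) ∈ X_W(7)`, Theorem 1.1's
quartic for `a = −27c₄`, `b = −54c₆`), `d₂₂(P) ≠ 0`, `H(F)(P) ≠ 0`, `c₄(F)(P) = u⁴·g₄·d₂₂(P)²` and `c₆(F)(P) = u⁶·g₆·d₂₂(P)³` (the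
member `E_P` of (4.8) for `(F, d₂₂)` is `ℚ`-isomorphic to `G` by the scaling `u`).  Then `G[7] ≅ W[7]` as `Γ_ℚ`-modules.  PROVED modulo
Fisher 2014 §4.4 (`(F, d₂₂)`) = the named fact `sec44_sevenCongruent_hkQuartic7_d22`.
[cite: Fisher2014SevenElevenCongruent, §4.4 with Thm. 4.6, (4.8), Thm. 1.1] -/
theorem sevenCongruent_of_hkD22Certificate7 (hF : sec44_sevenCongruent_hkQuartic7_d22)
    (W G : WeierstrassCurve ℚ) [W.IsElliptic] [G.IsElliptic] (c₄ c₆ g₄ g₆ x y z u : ℚ)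
    (hW4 : W.c₄ = c₄) (hW6 : W.c₆ = c₆) (hG4 : G.c₄ = g₄) (hG6 : G.c₆ = g₆) (h0 : c₄ ≠ 0) (h1728 : c₆ ≠ 0) (hu : u ≠ 0)
    (hP : TernaryPoly.eval x y z (cHKQuartic7 c₄ c₆) = 0)
    (hd : TernaryPoly.eval x y z (cHKCubic7d22 c₄ c₆) ≠ 0)
    (hH : hAt x y z (cHKQuartic7 c₄ c₆) ≠ 0)
    (h4 : c4At x y z (cHKQuartic7 c₄ c₆) = u ^ 4 * g₄ * TernaryPoly.eval x y z (cHKCubic7d22 c₄ c₆) ^ 2)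
    (h6 : c6At x y z (cHKQuartic7 c₄ c₆) = u ^ 6 * g₆ * TernaryPoly.eval x y z (cHKCubic7d22 c₄ c₆) ^ 3) :
    ∃ e : geomTorsion G (7 : ℤ) ≃+ geomTorsion W (7 : ℤ),
      ∀ (σ : Field.absoluteGaloisGroup ℚ) (T : geomTorsion G (7 : ℤ)), e (σ • T) = σ • e T := by
  have eP : MvPolynomial.eval ![x, y, z] (hkQuartic7 W.c₄ W.c₆) = 0 := by
    rw [hW4, hW6, ← toMv_cHKQuartic7, eval_toMv, hP]
  have ed : MvPolynomial.eval ![x, y, z] (hkCubic7d22 W.c₄ W.c₆) = TernaryPoly.eval x y z (cHKCubic7d22 c₄ c₆) := by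
    rw [hW4, hW6, ← toMv_cHKCubic7d22, eval_toMv]
  have eH : MvPolynomial.eval ![x, y, z] (kleinH (hkQuartic7 W.c₄ W.c₆)) ≠ 0 := by
    rw [hW4, hW6, ← toMv_cHKQuartic7, eval_kleinH_eq]; exact hH
  have e4 : MvPolynomial.eval ![x, y, z] (kleinC4 (hkQuartic7 W.c₄ W.c₆)) =
      u ^ 4 * G.c₄ * TernaryPoly.eval x y z (cHKCubic7d22 c₄ c₆) ^ 2 := by
    rw [hW4, hW6, ← toMv_cHKQuartic7, eval_kleinC4_eq, h4, hG4]
  have e6 : MvPolynomial.eval ![x, y, z] (kleinC6 (hkQuartic7 W.c₄ W.c₆)) =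
      u ^ 6 * G.c₆ * TernaryPoly.eval x y z (cHKCubic7d22 c₄ c₆) ^ 3 := by
    rw [hW4, hW6, ← toMv_cHKQuartic7, eval_kleinC6_eq, h6, hG6]
  have hA4 : -27 * (MvPolynomial.eval ![x, y, z] (kleinC4 (hkQuartic7 W.c₄ W.c₆)) /
      MvPolynomial.eval ![x, y, z] (hkCubic7d22 W.c₄ W.c₆) ^ 2) = -27 * (u ^ 4 * G.c₄) := by
    rw [e4, ed]; field_simp
  have hA6 : -54 * (MvPolynomial.eval ![x, y, z] (kleinC6 (hkQuartic7 W.c₄ W.c₆)) /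
      MvPolynomial.eval ![x, y, z] (hkCubic7d22 W.c₄ W.c₆) ^ 3) = -54 * (u ^ 6 * G.c₆) := by
    rw [e6, ed]; field_simp
  have hC : (⟨Units.mk0 u hu, 0, 0, 0⟩ : VariableChange ℚ) • hkMember7d22 W.c₄ W.c₆ x y z = c4c6Model G.c₄ G.c₆ := by
    rw [hkMember7d22]
    exact variableChange_shortModel_eq_c4c6Model G _ _ u hu hA4 hA6
  haveI : (hkMember7d22 W.c₄ W.c₆ x y z).IsElliptic := by
    rw [← inv_smul_smul (⟨Units.mk0 u hu, 0, 0, 0⟩ : VariableChange ℚ) (hkMember7d22 W.c₄ W.c₆ x y z), hC]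
    infer_instance
  have hd' : MvPolynomial.eval ![x, y, z] (hkCubic7d22 W.c₄ W.c₆) ≠ 0 := by rw [ed]; exact hd
  exact sevenCongruent_of_variableChange_eq_c4c6Model W G _ _ hC
    (sevenCongruent_hkMember7d22 hF W x y z (hW4 ▸ h0) (hW6 ▸ h1728) eP hd' eH)

/-! ### The three certificates (Cremona labels; models = Cremona's minimal models) -/

/-- **`341138n1[7] ≅ 341138s1[7]`** (`Γ_ℚ`-modules), from the point `P = (1 : −73101 : 0)` of `X_E(7)` in Halberstadt–Kraus
coordinates (`E = 341138s1`, `c₄ = 593750689 = 24367²`, `c₆ = −1226095172785`; `73101 = 3·24367`; `d₁ = 0` there), `u = 1154251339416`;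
partner `341138n1` (`c₄ = −37583`, `c₆ = −1722836521`, rank 2).  Kernel certificate; conditional only on Fisher 2014 §4.4 (`(F, d₂₂)`).
Exact check kit j288075. [cite: Fisher2014SevenElevenCongruent, §4.4] [cite: Cremona2006, Table 1 (Cremona labels 341138s1, 341138n1)] -/
theorem sevenCongruent_hk_341138s1_7 (hF : sec44_sevenCongruent_hkQuartic7_d22)
    {W F : WeierstrassCurve ℚ} [W.IsElliptic] [F.IsElliptic]
    (hWeq : W = ⟨1, 0, 0, -12369806, 1418060818⟩) (hFeq : F = ⟨1, 0, 0, 783, 1994089⟩) :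
    ∃ e : geomTorsion F (7 : ℤ) ≃+ geomTorsion W (7 : ℤ),
      ∀ (σ : Field.absoluteGaloisGroup ℚ) (T : geomTorsion F (7 : ℤ)), e (σ • T) = σ • e T := by
  refine sevenCongruent_of_hkD22Certificate7 hF W F 593750689 (-1226095172785) (-37583) (-1722836521)
    1 (-73101) 0 1154251339416 ?_ ?_ ?_ ?_ (by norm_num) (by norm_num) (by norm_num)
    (by decide +kernel) (by decide +kernel) (by decide +kernel) (by decide +kernel) (by decide +kernel)
  · subst hWeq; norm_num [WeierstrassCurve.c₄, WeierstrassCurve.b₂, WeierstrassCurve.b₄]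
  · subst hWeq; norm_num [WeierstrassCurve.c₆, WeierstrassCurve.b₂, WeierstrassCurve.b₄, WeierstrassCurve.b₆]
  · subst hFeq; norm_num [WeierstrassCurve.c₄, WeierstrassCurve.b₂, WeierstrassCurve.b₄]
  · subst hFeq; norm_num [WeierstrassCurve.c₆, WeierstrassCurve.b₂, WeierstrassCurve.b₄, WeierstrassCurve.b₆]

/-- **`223587cc1[7] ≅ 223587ck1[7]`**, from the point `P = (1 : 17199 : 0)` of `X_E(7)` in Halberstadt–Kraus coordinates
(`E = 223587ck1`, `c₄ = 32867289 = 5733²`, `c₆ = 672957742275`; `17199 = 3·5733`), `u = 63894009816`; partner `223587cc1`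
(`c₄ = −521703`, `c₆ = 2990923299`, rank 2).  Kernel certificate; conditional only on Fisher 2014 §4.4.  Exact check kit j288075.
[cite: Fisher2014SevenElevenCongruent, §4.4] [cite: Cremona2006, Table 1 (Cremona labels 223587ck1, 223587cc1)] -/
theorem sevenCongruent_hk_223587ck1_7 (hF : sec44_sevenCongruent_hkQuartic7_d22)
    {W F : WeierstrassCurve ℚ} [W.IsElliptic] [F.IsElliptic]
    (hWeq : W = ⟨1, -1, 0, -684735, -778715092⟩) (hFeq : F = ⟨1, -1, 0, 10869, -3464434⟩) :
    ∃ e : geomTorsion F (7 : ℤ) ≃+ geomTorsion W (7 : ℤ),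
      ∀ (σ : Field.absoluteGaloisGroup ℚ) (T : geomTorsion F (7 : ℤ)), e (σ • T) = σ • e T := by
  refine sevenCongruent_of_hkD22Certificate7 hF W F 32867289 672957742275 (-521703) 2990923299
    1 17199 0 63894009816 ?_ ?_ ?_ ?_ (by norm_num) (by norm_num) (by norm_num)
    (by decide +kernel) (by decide +kernel) (by decide +kernel) (by decide +kernel) (by decide +kernel)
  · subst hWeq; norm_num [WeierstrassCurve.c₄, WeierstrassCurve.b₂, WeierstrassCurve.b₄]
  · subst hWeq; norm_num [WeierstrassCurve.c₆, WeierstrassCurve.b₂, WeierstrassCurve.b₄, WeierstrassCurve.b₆]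
  · subst hFeq; norm_num [WeierstrassCurve.c₄, WeierstrassCurve.b₂, WeierstrassCurve.b₄]
  · subst hFeq; norm_num [WeierstrassCurve.c₆, WeierstrassCurve.b₂, WeierstrassCurve.b₄, WeierstrassCurve.b₆]

/-- **`84966dx1[7] ≅ 84966ea1[7]`**, from the point `P = (1 : −6069 : 0)` of `X_E(7)` in Halberstadt–Kraus coordinates
(`E = 84966ea1`, `c₄ = 4092529 = 2023²`, `c₆ = 70616587895`; `6069 = 3·2023`), `u = 7955876376`; partner `84966dx1` (`c₄ = 3772657`,
`c₆ = −7368045769`, rank 2).  Kernel certificate; conditional only on Fisher 2014 §4.4.  (The isogenous partner `84966dx2` is certified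
independently on `X_E⁻(7)` by Theorem 4.8: `…CompanionX4Klein84966ea1`.)  Exact check kit j288075.
[cite: Fisher2014SevenElevenCongruent, §4.4] [cite: Cremona2006, Table 1 (Cremona labels 84966ea1, 84966dx1)] -/
theorem sevenCongruent_hk_84966ea1_7 (hF : sec44_sevenCongruent_hkQuartic7_d22)
    {W F : WeierstrassCurve ℚ} [W.IsElliptic] [F.IsElliptic]
    (hWeq : W = ⟨1, 0, 0, -85261, -81739267⟩) (hFeq : F = ⟨1, 0, 0, -78597, 8521281⟩) :
    ∃ e : geomTorsion F (7 : ℤ) ≃+ geomTorsion W (7 : ℤ),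
      ∀ (σ : Field.absoluteGaloisGroup ℚ) (T : geomTorsion F (7 : ℤ)), e (σ • T) = σ • e T := by
  refine sevenCongruent_of_hkD22Certificate7 hF W F 4092529 70616587895 3772657 (-7368045769)
    1 (-6069) 0 7955876376 ?_ ?_ ?_ ?_ (by norm_num) (by norm_num) (by norm_num)
    (by decide +kernel) (by decide +kernel) (by decide +kernel) (by decide +kernel) (by decide +kernel)
  · subst hWeq; norm_num [WeierstrassCurve.c₄, WeierstrassCurve.b₂, WeierstrassCurve.b₄]
  · subst hWeq; norm_num [WeierstrassCurve.c₆, WeierstrassCurve.b₂, WeierstrassCurve.b₄, WeierstrassCurve.b₆]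
  · subst hFeq; norm_num [WeierstrassCurve.c₄, WeierstrassCurve.b₂, WeierstrassCurve.b₄]
  · subst hFeq; norm_num [WeierstrassCurve.c₆, WeierstrassCurve.b₂, WeierstrassCurve.b₄, WeierstrassCurve.b₆]

end Summit.BirchSwinnertonDyer.BirchSwinnertonDyer.Theorems.AdditiveBranchIMCGordTwoRankZeroCompanionKleinHK
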